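import Literature.NumberTheory.Sieve.HeathBrownCubicTypeIMoebius
import Literature.NumberTheory.Sieve.HeathBrownMorozClassLatticeCount
import HarnessLib

/-!
# Heath-Brown–Moroz 2004, §2: Möbius inversion over the common divisor for the class family ([3, (5.3)])

Fourth brick of the class Type-I estimate (crux `HeathBrownMorozUniform` of `Summits/Parity`).  The class
Type-I count `#𝒜_R(class)` (`classCountA`, coprime pairs) is expressed through class lattice counts without
coprimality at the scales `X/g` — the class analogue of the tree's `countA_eq_sum_moebius` ([3, (5.3)],
p. 30): `#𝒜_R(class) = ∑_{g ≥ 1} μ(g) #{x', y' ∈ (X/g, X(1+η)/g] : gx' ≡ a, gy' ≡ b (d), R ∣ (g)(x' + y'·2^{1/3})}`.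
For an admissible class only `g` coprime to `d` contribute (`p ∣ (g, d)` would give `p ∣ a, b`), and for
such `g` the condition `gx' ≡ a (d)` is the reduced class `x' ≡ a·g⁻¹ (d)`, again admissible.  Contents:
`card_filter_class_dvd_dvd_eq`, **`classCountA_eq_sum_moebius`**, `class_term_eq_zero_of_not_coprime`,
`exists_reduced_class_of_coprime` (the class `a g⁻¹ mod d`, admissible), `modEq_mul_iff_of_inverse`.

## References

* D. R. Heath-Brown, B. Z. Moroz, Proc. LMS (3) 88 (2004), §2 (2.4), Lemma 2.2. [cite: HeathBrownMoroz2004, Lemma 2.2]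
* D. R. Heath-Brown, Acta Math. 186 (2001), §5 (5.3). [cite: HeathBrownActa2001, §5 (5.3)]

## Mathlib / tree search

Tree: `ite_coprime_eq_sum_moebius`, `pairIdeal_mul_left`, `mul_mem_latticeBox_iff`, `countA_eq_sum_moebius`
(template) (`HeathBrownCubicTypeIMoebius`); `classAPairs`, `classCountA`, `mem_classAPairs_iff`, `mem_classPairs_iff`
(`HeathBrownMorozClassFamily`); `boxPairs_eq_filter_latticeBox`, `mem_latticeBox_iff` (`HeathBrownCubicTypeITools`);
Mathlib `Nat.Coprime`, `Nat.ModEq`, `Nat.chineseRemainder`-free: inverse via `Nat.exists_mul_emod_eq_one_of_coprime`.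
-/

noncomputable section

open Finset NumberField

namespace Literature.NumberTheory.Sieve.CubicSieve

open LFunctions.CubeRootTwoField CubicPrimes

open scoped Classical in
/-- The class pairs of the box with `R ∣ (x + y·2^{1/3})` and `g ∣ x`, `g ∣ y` are the pairs `(gx', gy')` with
`(x', y')` in the box scaled by `1/g`, `gx' ≡ a`, `gy' ≡ b (mod d)` and `R ∣ (g)·(x' + y'·2^{1/3})` (`g ≥ 1`).
[cite: HeathBrownActa2001, §5 (5.3)] -/
theorem card_filter_class_dvd_dvd_eq {X η : ℝ} {g : ℕ} (hg : 0 < g) (d a b : ℕ) (R : Ideal (𝓞 K)) :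
    #{xy ∈ latticeBox X η | (xy.1 ≡ a [MOD d] ∧ xy.2 ≡ b [MOD d] ∧ R ∣ pairIdeal xy) ∧ (g ∣ xy.1 ∧ g ∣ xy.2)} =
      #{xy ∈ latticeBox (X / g) η | g * xy.1 ≡ a [MOD d] ∧ g * xy.2 ≡ b [MOD d] ∧
        R ∣ Ideal.span {(g : 𝓞 K)} * pairIdeal xy} := by
  have hinj : Function.Injective fun xy : ℕ × ℕ => (g * xy.1, g * xy.2) := by
    intro u v h
    simp only [Prod.mk.injEq] at h
    exact Prod.ext (Nat.eq_of_mul_eq_mul_left hg h.1) (Nat.eq_of_mul_eq_mul_left hg h.2)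
  have himg : ({xy ∈ latticeBox X η | (xy.1 ≡ a [MOD d] ∧ xy.2 ≡ b [MOD d] ∧ R ∣ pairIdeal xy) ∧
      (g ∣ xy.1 ∧ g ∣ xy.2)} : Finset (ℕ × ℕ)) =
      ({xy ∈ latticeBox (X / g) η | g * xy.1 ≡ a [MOD d] ∧ g * xy.2 ≡ b [MOD d] ∧
        R ∣ Ideal.span {(g : 𝓞 K)} * pairIdeal xy}).image fun xy : ℕ × ℕ => (g * xy.1, g * xy.2) := by
    refine Finset.ext fun p => ?_
    rw [mem_filter, mem_image]
    constructor
    · rintro ⟨hbox, ⟨hma, hmb, hR⟩, ⟨x', hx'⟩, ⟨y', hy'⟩⟩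
      have hp : p = (g * x', g * y') := Prod.ext hx' hy'
      refine ⟨(x', y'), mem_filter.mpr ⟨(mul_mem_latticeBox_iff hg (x', y')).mp (hp ▸ hbox), ?_, ?_, ?_⟩, hp.symm⟩
      · simpa [hp] using hma
      · simpa [hp] using hmb
      · rw [← pairIdeal_mul_left]; simpa [hp] using hR
    · rintro ⟨⟨x', y'⟩, hmem, hxy⟩
      rw [mem_filter] at hmem
      obtain ⟨hbox, hma, hmb, hR⟩ := hmem
      subst hxy
      refine ⟨(mul_mem_latticeBox_iff hg (x', y')).mpr hbox, ⟨hma, hmb, ?_⟩, ⟨x', rfl⟩, ⟨y', rfl⟩⟩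
      rwa [← pairIdeal_mul_left] at hR
  rw [himg, card_image_of_injective _ hinj]

open scoped Classical in
/-- **Möbius inversion over the common divisor for the class ([3, (5.3)]):**
`#𝒜_R(class) = ∑_{1 ≤ g ≤ D} μ(g) #{x', y' ∈ (X/g, X(1+η)/g] : gx' ≡ a, gy' ≡ b (d), R ∣ (g)(x' + y'·2^{1/3})}`
for any `D ≥ ⌊X(1+η)⌋` (template: `countA_eq_sum_moebius`). [cite: HeathBrownActa2001, §5 (5.3)] -/
theorem classCountA_eq_sum_moebius {X η : ℝ} (hX : 0 ≤ X) (d a b : ℕ) (R : Ideal (𝓞 K)) {D : ℕ}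
    (hD : ⌊X * (1 + η)⌋₊ ≤ D) :
    (classCountA X η d a b R : ℤ) =
      ∑ g ∈ Icc 1 D, (ArithmeticFunction.moebius g : ℤ) *
        #{xy ∈ latticeBox (X / g) η | g * xy.1 ≡ a [MOD d] ∧ g * xy.2 ≡ b [MOD d] ∧
          R ∣ Ideal.span {(g : 𝓞 K)} * pairIdeal xy} := by
  set s : Finset (ℕ × ℕ) := {xy ∈ latticeBox X η | xy.1 ≡ a [MOD d] ∧ xy.2 ≡ b [MOD d] ∧ R ∣ pairIdeal xy}
    with hs
  clear_value s
  have hA : classAPairs X η d a b R = s.filter (fun xy => Nat.Coprime xy.1 xy.2) := by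
    refine Finset.ext fun xy => ?_
    rw [mem_classAPairs_iff, mem_classPairs_iff, boxPairs_eq_filter_latticeBox, mem_filter, hs, mem_filter,
      mem_filter]
    tauto
  have h1 : (classCountA X η d a b R : ℤ) = ∑ xy ∈ s, if Nat.Coprime xy.1 xy.2 then (1 : ℤ) else 0 := by
    rw [sum_boole, classCountA, hA]
  have hmem : ∀ xy ∈ s, X < xy.1 ∧ (xy.1 : ℝ) ≤ X * (1 + η) := by
    intro xy hxy
    rw [hs, mem_filter, mem_latticeBox_iff] at hxy
    exact ⟨hxy.1.1, hxy.1.2.1⟩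
  have hx0 : ∀ xy ∈ s, xy.1 ≠ 0 := by
    intro xy hxy h0
    have h := (hmem xy hxy).1
    rw [h0, Nat.cast_zero] at h
    linarith
  have hswap : ∀ (xy : ℕ × ℕ) (g : ℕ), xy ∈ s ∧ g ∈ (Nat.gcd xy.1 xy.2).divisors ↔
      xy ∈ s.filter (fun xy => g ∣ xy.1 ∧ g ∣ xy.2) ∧ g ∈ Icc 1 D := by
    intro xy g
    simp only [mem_filter, Nat.mem_divisors, mem_Icc]
    constructor
    · rintro ⟨hxy, hdg, -⟩
      have hdx : g ∣ xy.1 := hdg.trans (Nat.gcd_dvd_left _ _)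
      have hdy : g ∣ xy.2 := hdg.trans (Nat.gcd_dvd_right _ _)
      have hpos : 0 < xy.1 := Nat.pos_of_ne_zero (hx0 xy hxy)
      exact ⟨⟨hxy, hdx, hdy⟩, Nat.pos_of_dvd_of_pos hdx hpos,
        (Nat.le_of_dvd hpos hdx).trans ((Nat.le_floor (hmem xy hxy).2).trans hD)⟩
    · rintro ⟨⟨hxy, hdx, hdy⟩, -, -⟩
      exact ⟨hxy, Nat.dvd_gcd hdx hdy, fun h0 => hx0 xy hxy (Nat.eq_zero_of_gcd_eq_zero_left h0)⟩
  rw [h1]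
  simp_rw [ite_coprime_eq_sum_moebius]
  rw [sum_comm' hswap]
  refine sum_congr rfl fun g hg => ?_
  rw [mem_Icc] at hg
  rw [sum_const, nsmul_eq_mul, mul_comm, hs, filter_filter, card_filter_class_dvd_dvd_eq hg.1 d a b R]

open scoped Classical in
/-- **Only `g` coprime to `d` contribute** (admissible class): if a prime divides `g` and `d` then
`gx' ≡ a`, `gy' ≡ b (mod d)` force `p ∣ a, b`, contradicting `gcd(a³ + 2b³, d) = 1`; so the `g`-term vanishes.
[cite: HeathBrownMoroz2004, Lemma 2.4] -/
theorem class_term_eq_zero_of_not_coprime {X η : ℝ} {d a b g : ℕ} (hadm : Nat.Coprime (a ^ 3 + 2 * b ^ 3) d)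
    (hg : ¬ Nat.Coprime g d) (R : Ideal (𝓞 K)) :
    #{xy ∈ latticeBox X η | g * xy.1 ≡ a [MOD d] ∧ g * xy.2 ≡ b [MOD d] ∧
      R ∣ Ideal.span {(g : 𝓞 K)} * pairIdeal xy} = 0 := by
  rw [card_eq_zero]
  refine eq_empty_of_forall_notMem fun xy hxy => hg ?_
  rw [mem_filter] at hxy
  obtain ⟨-, hma, hmb, -⟩ := hxy
  -- `gcd(g, d)` divides `a` and `b`, hence `a³ + 2b³`; with `gcd(a³+2b³, d) = 1` this forces `gcd(g, d) = 1`
  set k := Nat.gcd g d with hk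
  have hkd : k ∣ d := Nat.gcd_dvd_right g d
  have hkg : k ∣ g := Nat.gcd_dvd_left g d
  have hka : k ∣ a := ((Nat.ModEq.of_dvd hkd hma).dvd_iff dvd_rfl).1 (dvd_mul_of_dvd_left hkg _)
  have hkb : k ∣ b := ((Nat.ModEq.of_dvd hkd hmb).dvd_iff dvd_rfl).1 (dvd_mul_of_dvd_left hkg _)
  have hk3 : k ∣ a ^ 3 + 2 * b ^ 3 := (dvd_pow hka (by norm_num)).add ((dvd_pow hkb (by norm_num)).mul_left 2)
  have hk1 : k = 1 := Nat.eq_one_of_dvd_coprimes hadm hk3 hkd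
  exact hk1

/-- Multiplication by a unit modulo `d`: if `g·u ≡ 1 (mod d)` then `g·x ≡ a ↔ x ≡ u·a (mod d)`. [cite: HeathBrownMoroz2004, §2] -/
theorem modEq_mul_iff_of_inverse {d g u a : ℕ} (hu : g * u ≡ 1 [MOD d]) (x : ℕ) :
    g * x ≡ a [MOD d] ↔ x ≡ u * a [MOD d] := by
  constructor
  · intro h
    have h1 : u * (g * x) ≡ u * a [MOD d] := h.mul_left u
    have h2 : u * (g * x) ≡ x [MOD d] := by
      have : u * (g * x) = (g * u) * x := by ring
      rw [this]
      simpa using hu.mul_right x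
    exact h2.symm.trans h1
  · intro h
    have h1 : g * x ≡ g * (u * a) [MOD d] := h.mul_left g
    have h2 : g * (u * a) ≡ a [MOD d] := by
      have : g * (u * a) = (g * u) * a := by ring
      rw [this]
      simpa using hu.mul_right a
    exact h1.trans h2

/-- **The `g`-term is a class lattice count for the reduced class `(a·g⁻¹, b·g⁻¹) mod d`**, which is again
admissible: for `g` coprime to `d ≥ 1` there are `a', b' < d` with `gcd(a'³ + 2b'³, d) = 1`,
`g·x ≡ a ↔ x ≡ a'` and `g·y ≡ b ↔ y ≡ b' (mod d)`. [cite: HeathBrownMoroz2004, §2] -/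
theorem exists_reduced_class_of_coprime {d a b g : ℕ} (hd : 0 < d) (hg : Nat.Coprime g d)
    (hadm : Nat.Coprime (a ^ 3 + 2 * b ^ 3) d) :
    ∃ a' b' : ℕ, a' < d ∧ b' < d ∧ Nat.Coprime (a' ^ 3 + 2 * b' ^ 3) d ∧
      (∀ x : ℕ, g * x ≡ a [MOD d] ↔ x ≡ a' [MOD d]) ∧ (∀ y : ℕ, g * y ≡ b [MOD d] ↔ y ≡ b' [MOD d]) := by
  rcases Nat.lt_or_ge 1 d with hd1 | hd1
  · obtain ⟨u, -, hu⟩ := Nat.exists_mul_mod_eq_one_of_coprime hg hd1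
    have hu' : g * u ≡ 1 [MOD d] := by
      rw [Nat.ModEq, hu, Nat.mod_eq_of_lt hd1]
    refine ⟨(u * a) % d, (u * b) % d, Nat.mod_lt _ hd, Nat.mod_lt _ hd, ?_, fun x => ?_, fun y => ?_⟩
    · -- `a'³ + 2b'³ ≡ u³(a³ + 2b³)` and `u` is a unit mod `d`
      have hmod : (u * a % d) ^ 3 + 2 * (u * b % d) ^ 3 ≡ u ^ 3 * (a ^ 3 + 2 * b ^ 3) [MOD d] := by
        have h1 : (u * a % d) ≡ u * a [MOD d] := Nat.mod_modEq _ _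
        have h2 : (u * b % d) ≡ u * b [MOD d] := Nat.mod_modEq _ _
        have h3 := (h1.pow 3).add ((h2.pow 3).mul_left 2)
        refine h3.trans ?_
        have : (u * a) ^ 3 + 2 * (u * b) ^ 3 = u ^ 3 * (a ^ 3 + 2 * b ^ 3) := by ring
        rw [this]
      rw [Nat.Coprime, hmod.gcd_eq]
      have hgu : Nat.Coprime u d := Nat.coprime_of_mul_modEq_one g (by simpa [mul_comm] using hu')
      exact Nat.Coprime.mul_left (Nat.Coprime.pow_left 3 hgu) hadm
    · rw [modEq_mul_iff_of_inverse hu' x]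
      exact ⟨fun h => h.trans (Nat.mod_modEq _ _).symm, fun h => h.trans (Nat.mod_modEq _ _)⟩
    · rw [modEq_mul_iff_of_inverse hu' y]
      exact ⟨fun h => h.trans (Nat.mod_modEq _ _).symm, fun h => h.trans (Nat.mod_modEq _ _)⟩
  · -- `d = 1`: every congruence holds
    have hd' : d = 1 := le_antisymm hd1 hd
    subst hd'
    refine ⟨0, 0, Nat.one_pos, Nat.one_pos, Nat.coprime_one_right _, fun x => ?_, fun y => ?_⟩ <;>
      simp [Nat.modEq_one]

open scoped Classical in
/-- Rewriting the `g`-term through the reduced class: the two filters agree pointwise. [cite: HeathBrownMoroz2004, §2] -/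
theorem card_filter_mul_modEq_eq {Y η : ℝ} {d a b g a' b' : ℕ}
    (ha : ∀ x : ℕ, g * x ≡ a [MOD d] ↔ x ≡ a' [MOD d]) (hb : ∀ y : ℕ, g * y ≡ b [MOD d] ↔ y ≡ b' [MOD d])
    (P : ℕ × ℕ → Prop) :
    #{xy ∈ latticeBox Y η | g * xy.1 ≡ a [MOD d] ∧ g * xy.2 ≡ b [MOD d] ∧ P xy} =
      #{xy ∈ latticeBox Y η | xy.1 ≡ a' [MOD d] ∧ xy.2 ≡ b' [MOD d] ∧ P xy} := by
  congr 1
  exact filter_congr fun xy _ => by rw [ha xy.1, hb xy.2]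

end Literature.NumberTheory.Sieve.CubicSieve

end
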